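import Summits.ResolutionOfSingularities.ResolutionOfSingularities.Theorems.EquisingularLiftEquisingularLiftNatSubmaxLinN
import Summits.ResolutionOfSingularities.ResolutionOfSingularities.Theorems.EquisingularLiftEquisingularLiftBlowupModelTransport
import HarnessLib

/-!
# Crux `EquisingularLift` (stmt-ResolutionOfSingularities-15660), line `Sketch` (v10c): the OPEN residual's conclusion — a REGULAR BLOW-UP MODEL — for
# every integral hypersurface of `ℙ^{r+2}_k̄` of degree `d + 2` with the codimension-2 linear subspace `V(x_{r+1}, x_{r+2})` of multiplicity `d + 1`,
# in the CRUX'S OWN BINDER SHAPE `(H, ι)`, EVERY dimension, EVERY characteristic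

[OURS · leafhand-res-equisingularlift-7 g0, 2026-08-31; cell `pub/decomp-res`] AI-produced, weaker than expert review; NOT a statement of any
manuscript; nothing here proves resolution of singularities in positive characteristic.  DEF-FREE helper (`--supports stmt-…-15660`); no `sorry`;
standard axioms; ZERO named hypotheses.

Bookkeeping over ✓ `SubmaxLinN.blowupModel_submaxLinN` (this generation: `V₊(Σ_{j≤r} x_j·A_j(x_{r+1},x_{r+2}) + C)` has a non-zero ideal sheaf
all of whose blow-ups are regular) and lh6 g2's transport ✓ `StrataSplit.blowupModel_of_range_eq` (p817268).

* ★★ `blowupModel_of_range_eq_submaxLinN` — for the crux's binders `ι : H ↪ ℙ^{r+2}_k` (closed immersion, `H` integral) with `range ι = V₊(F)`,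
  `F = Σ_{j≤r} x_j·A_j(x_{r+1},x_{r+2}) + C(x_{r+1},x_{r+2})` prime (`A_j` binary forms of degree `d + 1` not all zero, `C` of degree `d + 2`,
  no common zero on `ℙ¹`), `k = k̄`: `∃ 𝔞 ≠ ⊥` on `H` with all blow-ups regular.  An ALL-DIMENSION (`r ≥ 0`, so ambient `ℙⁿ` for every `n ≥ 2`,
  in particular `n ≥ 5`), ALL-CHARACTERISTIC family of instances of the conclusion of `stub_blowupModel_ge_five` — next to the cones
  (✓ `blowupModel_of_range_eq_cone/linCone`), the quadrics and the large-characteristic rung.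

Honest label: no registered stub closed; `stub_blowupModel_ge_five` stays OPEN.
-/

set_option linter.dupNamespace false -- mandated namespace `Summit.<Summit>.<Problem>` of this single-conjunct summit

noncomputable section

open CategoryTheory CategoryTheory.Limits AlgebraicGeometry TopologicalSpace
open MvPolynomial
open Literature.AlgebraicGeometry.Resolution
open Literature.AlgebraicGeometry.Motives Literature.AlgebraicGeometry.Motives.SmoothHypersurface
open Summit.ResolutionOfSingularities.ResolutionOfSingularities.Cruxes.EquisingularLiftNat.Sections

namespace Summit.ResolutionOfSingularities.ResolutionOfSingularities.Cruxes.EquisingularLift.StrataSplit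

variable {k : Type} [Field k] [IsAlgClosed k] {r d : ℕ}

/-- ★★ **REGULAR BLOW-UP MODEL FOR EVERY INTEGRAL HYPERSURFACE OF `ℙ^{r+2}_k̄` WITH `V(x_{r+1}, x_{r+2})` OF MULTIPLICITY `≥ deg − 1`**, in the
crux's binder shape: `ι : H ↪ ℙ^{r+2}_k` a closed immersion, `H` integral, `range ι = V₊(F)` with
`F = Σ_{j≤r} x_j·A_j(x_{r+1},x_{r+2}) + C(x_{r+1},x_{r+2})` prime ⟹ `∃ 𝔞 ≠ ⊥` on `H` all of whose blow-ups are regular — every `r`, every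
characteristic (✓ `SubmaxLinN.blowupModel_submaxLinN` + ✓ `blowupModel_of_range_eq`). [OURS · lh7] [cite: Hartshorne1977, II Cor. 5.16] -/
theorem blowupModel_of_range_eq_submaxLinN {H : Scheme.{0}} (ι : H ⟶ (projectiveSpace (r + 1 + 1) k).left) [IsClosedImmersion ι]
    [IsIntegral H] (A : Fin (r + 1) → MvPolynomial (Fin 2) k) (C : MvPolynomial (Fin 2) k)
    (hA : ∀ j, (A j).IsHomogeneous (d + 1)) (hC : C.IsHomogeneous (d + 2)) (F : MvPolynomial (Fin (r + 1 + 1 + 1)) k)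
    (hF : F = ∑ j : Fin (r + 1), (X (j.castSucc.castSucc) : MvPolynomial (Fin (r + 1 + 1 + 1)) k) *
        rename (fun b : Fin 2 => (⟨r + 1 + b, by omega⟩ : Fin (r + 1 + 1 + 1))) (A j) +
      rename (fun b : Fin 2 => (⟨r + 1 + b, by omega⟩ : Fin (r + 1 + 1 + 1))) C)
    (hprime : Prime F) (hAne : ∃ j, A j ≠ 0)
    (hnc : ∀ v : Fin 2 → k, v ≠ 0 → ¬ ((∀ j, MvPolynomial.eval v (A j) = 0) ∧ MvPolynomial.eval v C = 0))
    (hrange : letI := MvPolynomial.gradedAlgebra (σ := Fin (r + 1 + 1 + 1)) (R := k)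
      Set.range ι = {x : Proj (homogeneousSubmodule (Fin (r + 1 + 1 + 1)) k) | F ∈ x.asHomogeneousIdeal}) :
    ∃ 𝔞 : H.IdealSheafData, 𝔞 ≠ ⊥ ∧ ∀ (Z : Scheme.{0}) (π : Z ⟶ H), IsBlowup π 𝔞 → Scheme.IsRegular Z := by
  have hFh : F.IsHomogeneous (d + 2) := by
    rw [hF]
    exact SubmaxLinN.isHomogeneous_shape k A C hA hC
  exact blowupModel_of_range_eq ι F hFh hprime hrange
    (SubmaxLinN.blowupModel_submaxLinN k A C hA hC F hF hFh hprime hAne hnc)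

end Summit.ResolutionOfSingularities.ResolutionOfSingularities.Cruxes.EquisingularLift.StrataSplit

end
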